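import Literature.MathematicalPhysics.QuantumFieldTheory.Balaban1983to89.B13ChainWalkDecoration
import Literature.MathematicalPhysics.QuantumFieldTheory.Balaban1983to89.Node00.CarriersB13KernelTower

/-!
# `Balaban1983to89.B13SigmaFreeKernels` — T. Bałaban, *Renormalization group approach to lattice gauge field theories. II.
Cluster expansions*, Commun. Math. Phys. **116** (1988) 1–22 [Balaban1988RG2Cluster], (2.14) p. 15, (2.8) p. 14, (1.11)
p. 5, p. 13; [13] = *Propagators for lattice gauge theories in a background field*, Commun. Math. Phys. **99** (1985) 389–434
[Balaban1985BackgroundPropagators], (3.108) p. 416: WHAT THE σ₀-PARAMETERS OF (2.14) DO TO A σ-FREE KERNEL FAMILY — the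
Cauchy device `(1∕2πi)∮dσ∕(σ−s)²` of the printed operator of (2.14) ANNIHILATES σ-constants, so (i) `B13Term214.term214` of a
σ-free X-integral vanishes as soon as `Z ∖ Z′₀ ≠ ∅`; (ii) in def-B13's dictionary (`Node00.CarriersB13KernelTower.ResidB13K`)
a kernel record whose NODE-A operators do not depend on `σ` at the term's configuration has ITS (2.14) TERM OF RECORD EQUAL
TO ZERO off `Z′₀`, hence `H(Z) = 0` when all terms of `Z` are such; (iii) `B13ChainWalkDecoration.structuredExpansion_of_factorData`
(node N10's module 28) admits the EMPTY cube assignment and then expands a σ-FREE operator — the cube letters of the N10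
junction editions are one-sided sufficient conditions, the s-dependence of record is owed by the OBJECT (the σ₀-cubes met by
a walk, p. 13), not by the letters; (iv) the common affine form of the two absorption letters in play (module 28's chain
letter, `B13EntrywiseWalks`' geodesic letter).  An HONESTY THEOREM for node N10's junction: every clause set that accepts
`J ≡ ∅` describes, off `Z′₀`, the zero term.

statement-level bookkeeping over published displays with citation tags; kernel-checked; `theorem`s only (no `def`, no
instance, no notation); nothing here is a claim about the Yang–Mills mass gap; nothing of Bałaban's is constructed; no node
is discharged; count-neutral.

PROVENANCE.  PORT (cell `pub-ymgap`, D-0062 Track A, node N10 = [B13]; seat `pub-ymgap-dag-n10-c` g4, module 35) of cell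
`ym-nodeO-ideate`'s ROUTE-P2 companion 20 `pub/ym-nodeO-ideate/memos/ROUTE-P2-files/SketchSigmaFreeT3.lean` (seat P2 g31,
memo `ROUTE-P2.md` v3.39 §S57; sha256 c1fdcc02a0f79addb9775fbd68fad85ba2e63403fbbd4595e8b69e4793f70472; farm rc 0, 0 warnings,
std axioms there), on P2's explicit GO («the same GO stands in advance for anything you wish to port from companion 20», bus
2026-08-27T06:12:30Z): declarations BYTE-IDENTICAL to the companion except (i) the namespace `YM.NodeO.P2.SigmaFreeT3` → this
Literature namespace, (ii) this header, (iii) one helper docstring whose `[folklore]` tag is replaced by a `[cite:]` locator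
(Literature lint; statement and proof untouched).  Tree sibling (Summits-side, not importable here, not restated):
`Summits/QuantumFields/BalabanUV/Beta/DecouplingResummation110.lean`'s `circleIntegral_inv_sq_smul_const` (the same
`∮(σ−s)⁻²dσ = 0` device in the ₁₁₀ resummation).  The companion's own module docstring follows verbatim between the rules.

────────────────────────────────────────────────────────────────────────────────────────────────────────────────────────
# ROUTE-P2 companion 20 (memo-side sketch, seat P2 g31) — what the σ₀-parameters of (2.14) do to a σ-FREE kernel family

Cell `ym-nodeO-ideate`, lens «around Bałaban», supplement S57 of `memos/ROUTE-P2.md` v3.39.  Memo-side Lean: it imports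
tree modules only, is kernel-checked by `lean check`, and is NOT a tree file (README §2 guard: nothing here is filed).

WHAT IS CHECKED HERE (all elementary; T-57.k are the memo's locators):

* §1 (T-57.2) the Cauchy device of [B12] (2.14), `cauchyD r f s = (1/2πi)∮ dσ/(σ−s)² f(σ)`, ANNIHILATES σ-constants
  (`∮ (σ−s)⁻² dσ = 0`), hence the printed operator `TopC r l` kills every function that does not depend on the listed
  parameters as soon as the list is non-empty, and `term214 r lZ lD Ψ σ₀ τ₀ = 0` for a σ-free `Ψ` and `lZ ≠ []`;
* §2 (T-57.3) consequently, in def-B13's dictionary (`Node00.CarriersB13KernelTower`: `T₃ := term214 r (Z∖Z′₀) 𝐃 core 0 0`,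
  `core := core214 (σ ↦ A2 σ u) Γ F`, `Γ σ X := G2 σ u · X`), a kernel record whose operators `A2`, `G2` do not depend
  on `σ` at the term's configuration has its (2.14) TERM OF RECORD EQUAL TO ZERO on every `Z` with `Z ∖ Z′₀ ≠ ∅` — and the
  junction-shaped bound `‖T‖ ≤ ‖term214 … (core214 (σ ↦ A₀) (σ ↦ Γ₀) F) σ₀ τ₀‖` forces `T = 0`;
* §3 (T-57.1) module 28's final theorem `B13ChainWalkDecoration.structuredExpansion_of_factorData` ADMITS THE EMPTY CUBE
  ASSIGNMENT (`cubes_R = cubes₀ = ∅`, `n_c = 0`: its five geometric binders `hcR hc₀ hcRX hc₀X habs` are then trivially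
  met), and the conditioned operator it expands is then σ-FREE (`sDecorate (ω ↦ ∅) T₀ σ u` does not depend on `σ`) — so
  the `hKexp`-shaped conclusion is inhabited by a σ-constant operator family: the letters are one-sided sufficient
  conditions and do not pin the s-dependence of record (census R-56.5 ∕ R-57.2);
* §4 (T-57.4) the common affine form of the two absorption letters in play — module 28's chain letter
  (`|J| ≤ n_c(|l|+1)`, penalty `s|l|`, `absorb_chain`) and companion 19 §3's geodesic letter (`|J| ≤ c₀ + D∕M₁`):
  both are `|J ω| ≤ m₀ + λ·D ω a b ⟹ κ₁|J ω| ≤ κ₁m₀ + (κ₁λ)·D ω a b`, with `λ = n_c∕s` read off the STEP COUNT in one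
  case and `λ = 1∕M₁` read off the END-TO-END DISTANCE in the other (siblings; neither implies the other).

Sources: [Balaban1988RG2Cluster] T. Bałaban, CMP 116 (1988) 1–22, (2.14) p. 15, (2.8) p. 14, (1.11) p. 5, p. 13;
[Balaban1985BackgroundPropagators] CMP 99 (1985) 389–434, (3.108) p. 416.  Mathlib: `circleIntegral.integral_sub_zpow_of_ne`.
────────────────────────────────────────────────────────────────────────────────────────────────────────────────────────
-/

noncomputable section

namespace Literature.MathematicalPhysics.QuantumFieldTheory.Balaban1983to89.B13SigmaFreeKernels

open Complex MeasureTheory Metric Set Finset Matrix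
open scoped Real Matrix
open Literature.MathematicalPhysics.QuantumFieldTheory.Balaban1983to89
open Literature.MathematicalPhysics.QuantumFieldTheory.Balaban1983to89.B13Term214
open Literature.MathematicalPhysics.QuantumFieldTheory.Balaban1983to89.Node00
open Literature.MathematicalPhysics.QuantumFieldTheory.Balaban1983to89.TreeLengthTorus (TDom TPt)
open Literature.MathematicalPhysics.QuantumFieldTheory.Balaban1983to89.TreeLengthTorusTransfer (tclosure)
open Literature.MathematicalPhysics.QuantumFieldTheory.Balaban1983to89.B13Lemma3TorusTerms (terms Z0)
open Literature.MathematicalPhysics.QuantumFieldTheory.Balaban1983to89.B5TorusCover (UT)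
open Literature.MathematicalPhysics.QuantumFieldTheory.Balaban1983to89.B9Thm34Ext (toB6)
open Literature.MathematicalPhysics.QuantumFieldTheory.Balaban1983to89.B9Thm37GlueTorus (torusGeom tdist1)
open Literature.MathematicalPhysics.QuantumFieldTheory.Balaban1983to89.B13JointWalkExpansion (JointWalkExpansion)
open Literature.MathematicalPhysics.QuantumFieldTheory.Balaban1983to89.B13DomainKernelWalks (DomainTerms)
open Literature.MathematicalPhysics.QuantumFieldTheory.Balaban1983to89.B13DomainKernelWalksDecay (IsDomainLocalD)
open Literature.MathematicalPhysics.QuantumFieldTheory.Balaban1983to89.B13Eq111SDecoupling (sTerm sDecorate sTerm_apply sDecorate_apply)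
open Literature.MathematicalPhysics.QuantumFieldTheory.Balaban1983to89.B13JointWalkExpansionSymmetrize (jointWalkExpansion_congr_on)
open Literature.MathematicalPhysics.QuantumFieldTheory.Balaban1983to89.B13ChainWalkDecoration (structuredExpansion_of_factorData)

/-! ## §1 (T-57.2). The Cauchy device of (2.14) annihilates σ-constants -/

section CauchyConst

variable {E : Type*} [NormedAddCommGroup E] [NormedSpace ℂ E] [CompleteSpace E]

/-- `∮_{|σ−s|=r} dσ/(σ−s)² = 0` (the integrand is the derivative of `−(σ−s)⁻¹`; Mathlib's
`circleIntegral.integral_sub_zpow_of_ne` at the exponent `−2 ≠ −1`). [cite: Balaban1988RG2Cluster, (2.14) p.15 (elementary property of the display)] -/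
theorem circleIntegral_one_div_sub_sq (s : ℂ) (r : ℝ) : (∮ σ in C(s, r), (1 / (σ - s) ^ 2 : ℂ)) = 0 := by
  have h := circleIntegral.integral_sub_zpow_of_ne (show (-2 : ℤ) ≠ -1 by decide) s s r
  have e : (fun σ : ℂ => (1 / (σ - s) ^ 2 : ℂ)) = fun σ => (σ - s) ^ (-2 : ℤ) := by
    funext σ
    rw [_root_.zpow_neg, zpow_ofNat, one_div]
  rw [e]
  exact h

/-- **The (2.14) factor of a CONSTANT is zero**: `(1/2πi)∮ dσ/(σ−s)² · e = 0`. [cite: Balaban1988RG2Cluster, (2.14) p.15 (elementary property of the display)] -/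
theorem cauchyD_const (r : ℝ) (e : E) (s : ℂ) : cauchyD r (fun _ => e) s = 0 := by
  unfold cauchyD
  rw [circleIntegral.integral_smul_const, circleIntegral_one_div_sub_sq, zero_smul, smul_zero]

variable {ι : Type*} {instι : DecidableEq ι}

/-- **The printed operator of (2.14) applied to a function of NO parameter**: `TopC r l (p ↦ e) = e` for the empty list and
`= 0` as soon as one factor `∫₀¹ds (1/2πi)∮dσ/(σ−s)²` is present. [cite: Balaban1988RG2Cluster, (2.14) p.15 (elementary property of the display)] -/
theorem TopC_const (r : ℝ) (e : E) : ∀ (l : List ι) (p : ι → ℂ), TopC r l (fun _ => e) p = if l = [] then e else 0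
  | [], _ => by simp [TopC]
  | i :: l, p => by
    have ih : ∀ z : ℂ, TopC r l (fun _ => e) (Function.update p i z) = if l = [] then e else 0 :=
      fun z => TopC_const r e l _
    simp only [TopC, ih, cauchyD_const, intervalIntegral.integral_zero]
    simp

/-- Non-empty list: `TopC r l (p ↦ e) p₀ = 0`. [cite: Balaban1988RG2Cluster, (2.14) p.15 (elementary property of the display)] -/
theorem TopC_const_of_ne_nil (r : ℝ) (e : E) {l : List ι} (hl : l ≠ []) (p : ι → ℂ) : TopC r l (fun _ => e) p = 0 := by
  rw [TopC_const, if_neg hl]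

variable {κ : Type*} {instκ : DecidableEq κ}

/-- **(2.14) OF A σ-FREE X-INTEGRAL VANISHES** as soon as `Z ∖ Z′₀ ≠ ∅`: `term214 r lZ lD ((σ,τ) ↦ Ψ τ) σ₀ τ₀ = 0` for
`lZ ≠ []` (the inner τ-operator of `Ψ` is a σ-constant; one σ-factor kills it). [cite: Balaban1988RG2Cluster, (2.14) p.15 and (2.8) p.14] -/
theorem term214_sigmaFree (r : ℝ) {lZ : List ι} (hlZ : lZ ≠ []) (lD : List κ) (Ψ : (κ → ℂ) → E) (σ₀ : ι → ℂ)
    (τ₀ : κ → ℂ) : term214 r lZ lD (fun _ => Ψ) σ₀ τ₀ = 0 := by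
  simp only [term214]
  exact TopC_const_of_ne_nil r _ hlZ σ₀

omit [CompleteSpace E] in
/-- Honesty: with NO σ-parameter (`Z = Z′₀`, `lZ = []`) the display is the τ-operator of `Ψ` — not zero in general.
[cite: Balaban1988RG2Cluster, (2.14) p.15 (elementary property of the display)] -/
theorem term214_nil (r : ℝ) (lD : List κ) (Ψ : (ι → ℂ) → (κ → ℂ) → E) (σ₀ : ι → ℂ) (τ₀ : κ → ℂ) :
    term214 r [] lD Ψ σ₀ τ₀ = TopC r lD (fun τ => Ψ σ₀ τ) τ₀ := rfl

end CauchyConst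

/-! ## §2 (T-57.3). In def-B13's dictionary a σ-free kernel record has ZERO terms of record off `Z′₀` -/

section Junction

variable {Λ : Type} [Fintype Λ] {instΛ : DecidableEq Λ} {C : Type} [Fintype C] {instC : DecidableEq C}
variable {ι : Type*} {instι : DecidableEq ι} {D : Type*} {instD : DecidableEq D}

/-- The X-integral `core214` of σ-CONSTANT operator families is σ-free (definitional). [cite: Balaban1988RG2Cluster, (2.14) p.15] -/
theorem core214_sigmaFree (A₀ : Matrix Λ Λ ℂ) (Γ₀ : (Λ ⊕ C → ℝ) → (Λ → ℂ)) (F : (D → ℂ) → (Λ → ℝ) → ℂ) :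
    core214 (fun _ : ι → ℂ => A₀) (fun _ => Γ₀) F = fun _ => core214 (fun _ : ι → ℂ => A₀) (fun _ => Γ₀) F 0 := rfl

/-- **The (2.14) display of σ-constant operator families is ZERO** whenever `Z ∖ Z′₀ ≠ ∅`. [cite: Balaban1988RG2Cluster, (2.14) p.15 and (2.8) p.14] -/
theorem term214_core214_sigmaFree (r : ℝ) {lZ : List ι} (hlZ : lZ ≠ []) (lD : List D) (A₀ : Matrix Λ Λ ℂ)
    (Γ₀ : (Λ ⊕ C → ℝ) → (Λ → ℂ)) (F : (D → ℂ) → (Λ → ℝ) → ℂ) (σ₀ : ι → ℂ) (τ₀ : D → ℂ) :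
    term214 r lZ lD (core214 (fun _ : ι → ℂ => A₀) (fun _ => Γ₀) F) σ₀ τ₀ = 0 := by
  rw [core214_sigmaFree]
  exact term214_sigmaFree r hlZ lD _ σ₀ τ₀

/-- **THE JUNCTION-SHAPED CONSEQUENCE**: a quantity dominated — in the shape of module 21's dictionary binder `hT₃` — by the
(2.14) display of σ-CONSTANT operators is ZERO whenever `Z ∖ Z′₀ ≠ ∅`. [cite: Balaban1988RG2Cluster, (2.14) p.15 and (2.8) p.14] -/
theorem eq_zero_of_norm_le_term214_sigmaFree {T : ℂ} (r : ℝ) {lZ : List ι} (hlZ : lZ ≠ []) (lD : List D)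
    (A₀ : Matrix Λ Λ ℂ) (Γ₀ : (Λ ⊕ C → ℝ) → (Λ → ℂ)) (F : (D → ℂ) → (Λ → ℝ) → ℂ) (σ₀ : ι → ℂ) (τ₀ : D → ℂ)
    (hT : ‖T‖ ≤ ‖term214 r lZ lD (core214 (fun _ : ι → ℂ => A₀) (fun _ => Γ₀) F) σ₀ τ₀‖) : T = 0 := by
  rw [term214_core214_sigmaFree r hlZ, norm_zero] at hT
  exact norm_le_zero_iff.1 hT

variable {θ : Stage3Params} (lamK : ResidB13K θ)

/-- In def-B13's dictionary: if NODE A's operators `A2 = C^{(k)}(Z₀,σ)⁻¹`, `G2 = Γ_k(Z₀,σ)` of the term do not depend on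
`σ` at the term's configuration, the X-integral `Ψ(σ,τ)` of (2.14) is σ-free. [cite: Balaban1988RG2Cluster, (2.14) p.15] -/
theorem ResidB13K_core_sigmaFree {Z : TDom 4 (lamK.n + 1)} {t : B13TermIdx θ lamK.n lamK.m₃} (φ : lamK.Φ)
    (hA : ∀ σ, (lamK.𝒦 Z t).A2 σ (lamK.uOf Z t φ) = (lamK.𝒦 Z t).A2 0 (lamK.uOf Z t φ))
    (hG : ∀ σ, (lamK.𝒦 Z t).G2 σ (lamK.uOf Z t φ) = (lamK.𝒦 Z t).G2 0 (lamK.uOf Z t φ)) :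
    lamK.core Z t φ = fun _ τ => lamK.core Z t φ 0 τ := by
  have hGam : ∀ σ, lamK.Gam Z t φ σ = lamK.Gam Z t φ 0 := fun σ => funext fun X => by
    rw [ResidB13K.Gam_eq, ResidB13K.Gam_eq, hG σ]
  funext σ τ
  simp only [ResidB13K.core, core214, hA σ, hGam σ]

/-- **THE (2.14) TERM OF RECORD OF A σ-FREE KERNEL RECORD IS ZERO on every `Z` with `Z ∖ Z′₀ ≠ ∅`** (whatever the frame,
the χ-bond sets, the radius `r`): the decoupling content of (2.8)∕(2.14) is carried by the s-dependence of the kernels OF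
RECORD and by nothing else in the dictionary. [cite: Balaban1988RG2Cluster, (2.14) p.15, (2.8) p.14, p.13] -/
theorem ResidB13K_T₃_eq_zero_of_sigmaFree {Z : TDom 4 (lamK.n + 1)} {t : B13TermIdx θ lamK.n lamK.m₃} (φ : lamK.Φ)
    (hA : ∀ σ, (lamK.𝒦 Z t).A2 σ (lamK.uOf Z t φ) = (lamK.𝒦 Z t).A2 0 (lamK.uOf Z t φ))
    (hG : ∀ σ, (lamK.𝒦 Z t).G2 σ (lamK.uOf Z t φ) = (lamK.𝒦 Z t).G2 0 (lamK.uOf Z t φ))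
    (hZ : (Z.1 \ tclosure (θ.ℓ₆ + 1) (lamK.n + 1) (Z0 (lamK.m₃ + 1) t)).Nonempty) : lamK.T₃ Z t φ = 0 := by
  unfold ResidB13K.T₃
  rw [ResidB13K_core_sigmaFree lamK φ hA hG]
  exact term214_sigmaFree _ (Finset.Nonempty.toList_ne_nil hZ) _ _ _ _

/-- **THE CHAIN THROUGH THE JUNCTION's DICTIONARY** (module 21 ∕ 30's binders `hKA2 : A2 σ u = (KK σ u).toBlocks₁₁`,
`hKG2 : G2 σ u = [0 | (KK σ u).toBlocks₁₂]·invSqrt(KK σ u)` read abstractly as «`A2`, `G2` are functions `fA`, `fG` of the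
conditioned operator `KK`»): if the conditioned operator at the configuration does not depend on `σ` — e.g. module 30's
DEFINITION `hKK : KK = Cᵀ·sDecorate(J′, T₀ˢʸᵐ)·C` with the EMPTY decoration `J′ ≡ ∅` (§3) — then the term of record is
ZERO on every `Z ⊋ Z′₀`. [cite: Balaban1988RG2Cluster, (2.14) p.15, (2.5)–(2.6) p.12, p.13] -/
theorem ResidB13K_T₃_eq_zero_of_dictionary_sigmaFree {Z : TDom 4 (lamK.n + 1)} {t : B13TermIdx θ lamK.n lamK.m₃}
    (φ : lamK.Φ) {M : Type*} (KKu : (TPt 4 (lamK.n + 1) → ℂ) → M)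
    (fA : M → Matrix (lamK.𝒦 Z t).Λ (lamK.𝒦 Z t).Λ ℂ) (fG : M → Matrix (lamK.𝒦 Z t).Λ ((lamK.𝒦 Z t).Λ ⊕ (lamK.𝒦 Z t).C₀) ℂ)
    (hA : ∀ σ, (lamK.𝒦 Z t).A2 σ (lamK.uOf Z t φ) = fA (KKu σ)) (hG : ∀ σ, (lamK.𝒦 Z t).G2 σ (lamK.uOf Z t φ) = fG (KKu σ))
    (hKK : ∀ σ, KKu σ = KKu 0)
    (hZ : (Z.1 \ tclosure (θ.ℓ₆ + 1) (lamK.n + 1) (Z0 (lamK.m₃ + 1) t)).Nonempty) : lamK.T₃ Z t φ = 0 :=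
  ResidB13K_T₃_eq_zero_of_sigmaFree lamK φ (fun σ => by rw [hA, hA, hKK]) (fun σ => by rw [hG, hG, hKK]) hZ

/-- Hence the H OF RECORD of `Z` VANISHES when every term `(𝐃,P)` of `Z` has σ-free operators at the configuration and
`Z ⊋ Z′₀(𝐃,P)` — e.g. for a kernel family built WITHOUT the s-decoration of p. 13 (`J ≡ ∅` in (1.11)).
[cite: Balaban1988RG2Cluster, (2.9) p.14, (2.14) p.15, p.13] -/
theorem ResidB13K_H_layer_eq_zero_of_sigmaFree (Z : TDom 4 (lamK.n + 1)) (φ : lamK.Φ)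
    (hK : ∀ t ∈ terms (θ.ℓ₆ + 1) (lamK.m₃ + 1) Z,
      (∀ σ, (lamK.𝒦 Z t).A2 σ (lamK.uOf Z t φ) = (lamK.𝒦 Z t).A2 0 (lamK.uOf Z t φ)) ∧
      (∀ σ, (lamK.𝒦 Z t).G2 σ (lamK.uOf Z t φ) = (lamK.𝒦 Z t).G2 0 (lamK.uOf Z t φ)))
    (hZ : ∀ t ∈ terms (θ.ℓ₆ + 1) (lamK.m₃ + 1) Z, (Z.1 \ tclosure (θ.ℓ₆ + 1) (lamK.n + 1) (Z0 (lamK.m₃ + 1) t)).Nonempty) :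
    lamK.layer.H Z φ = 0 := by
  rw [ResidB13K.H_layer]
  refine Finset.sum_eq_zero fun t ht => ?_
  obtain ⟨hA, hG⟩ := hK t ht
  exact ResidB13K_T₃_eq_zero_of_sigmaFree lamK φ hA hG (hZ t ht)

end Junction

/-! ## §3 (T-57.1). Module 28's final theorem admits the EMPTY cube assignment — and then expands a σ-FREE operator -/

section EmptyCubes

variable {ν : ℕ} {Nf : Fin ν → ℕ} [∀ i, NeZero (Nf i)]
variable {d N' : ℕ} {n q : Type}
variable {E : Type*} [NormedAddCommGroup E] [NormedSpace ℂ E]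

/-- A chain that meets NO cube collects no cube: `foldr (i S ↦ ∅ ∪ S) ∅ l = ∅`. [cite: Balaban1988RG2Cluster, p.13 (elementary property of the cube assignment)] -/
theorem foldr_empty_union {α β : Type*} [DecidableEq β] (l : List α) :
    l.foldr (fun _ S => (∅ : Finset β) ∪ S) ∅ = ∅ := by
  induction l with
  | nil => rfl
  | cons _ l ih =>
    show ∅ ∪ List.foldr (fun _ S => (∅ : Finset β) ∪ S) ∅ l = ∅
    rw [ih, Finset.empty_union]

variable {p' : Type} {W : Type}

omit [NormedAddCommGroup E] [NormedSpace ℂ E] in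
/-- **An s-decoration by EMPTY cube sets is no decoration**: `sDecorate J T₀ σ u` does not depend on `σ` when `J ≡ ∅`
((1.11) with `m(ω) = 0` for every walk). [cite: Balaban1988RG2Cluster, (1.11) p.5 (the case m = 0)] -/
theorem sDecorate_sigmaFree_of_forall_empty (J : W → Finset (TPt d N')) (hJ : ∀ ω, J ω = ∅)
    (T₀ : W → E → Matrix p' n ℂ) (σ σ' : TPt d N' → ℂ) (u : E) : sDecorate J T₀ σ u = sDecorate J T₀ σ' u := by
  ext i j
  simp only [sDecorate_apply, sTerm_apply, hJ, Finset.prod_empty]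

variable {c : B13.Consts} {locn : n → UT Nf} {X : Finset (UT Nf)} {R : ℝ}

variable [Fintype n] [DecidableEq n] {locN : q → UT Nf}
variable {L₀ : DomainTerms d N' ν Nf n n E} {LR : DomainTerms d N' ν Nf n n E}
variable {lam₀ ρ₀ r₀ lamR ρR rR : ℝ} {n₀ nR m : ℕ}

/-- **MODULE 28's FINAL THEOREM WITH THE EMPTY CUBE ASSIGNMENT** (`cubes_R = cubes₀ = ∅`, `n_c = 0`; any rate `0 ≤ η ≤ ε`, any
penalty `s ≥ 0`): its five geometric binders `hcR hc₀ hcRX hc₀X habs` hold trivially, and the conclusion — module 21's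
`hKexp` shape — is reached VERBATIM for the operator `Cᵀ·sDecorate(ω ↦ ∅ ∪ … ∪ ∅, T₀ˢʸᵐ)·C`.  (Instance of
`B13ChainWalkDecoration.structuredExpansion_of_factorData`; nothing new is proved.) [cite: Balaban1988RG2Cluster, p.3, (1.11) p.5, p.13, p.15; Balaban1985BackgroundPropagators, (3.108) p.416] -/
theorem structuredExpansion_of_factorData_emptyCubes
    (h₀ : IsDomainLocalD L₀ c locn locn X R lam₀ ρ₀ r₀ 0 n₀) (hR : IsDomainLocalD LR c locn locn X R lamR ρR rR 0 nR)
    (hκ₁ : 0 ≤ c.κ₁) (hlam₀ : 0 ≤ lam₀) (hlamR : 0 ≤ lamR)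
    (hfib : ∀ y : UT Nf, (Finset.univ.filter fun k => locn k = y).card ≤ m)
    {ρ ε κ μ s : ℝ} (hμ : 0 < μ) (hε : 0 ≤ ε) (hκ : 0 ≤ κ) (hwin : κ + 2 * μ ≤ ρ - ε) (hρR : ρ + μ ≤ ρR) (hρ₀ : ρ ≤ ρ₀)
    (hs : 0 ≤ s)
    (hq : (m * B6.c0 1 μ ^ ν) * (Real.exp ((ρR - (ρ - ε)) * s) * (lamR * Real.exp (μ * rR) * (nR * B6.c0 1 μ ^ ν))) *
      B6.c0 1 μ ^ ν < 1)
    {η : ℝ} (hη : 0 ≤ η) (hηε : η ≤ ε)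
    (C : Matrix n q ℝ) {rC : ℝ} (hCle : ∀ k i, |C k i| ≤ 1)
    (hCsupp : ∀ k i, C k i ≠ 0 → tdist1 Nf (locn k) (locN i) ≤ rC)
    {mF : ℕ} (hfibF : ∀ y : UT Nf, (Finset.univ.filter fun k => locn k = y).card ≤ mF)
    {μ' : ℝ} (hμ' : 0 < μ') (hμ'ε : 2 * μ' ≤ ε - η) (hμ'κ : 2 * μ' ≤ κ) :
    ∃ (W' : Type) (T' : W' → (TPt d N' → ℂ) → E → Matrix q q ℂ) (SX' : Set W') (A' : W' → ℝ)
      (D' : W' → UT Nf → UT Nf → ℝ) (ρ' : ℝ) (J' : W' → Finset (TPt d N')) (T0' : W' → E → Matrix q q ℂ) (rev' : W' ≃ W'),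
      JointWalkExpansion c locN locN
          (fun σ u => (C.map (algebraMap ℝ ℂ))ᵀ *
            sDecorate (fun ω : (List LR.B × L₀.B) ⊕ (List LR.B × L₀.B) =>
                (Sum.elim id id ω).1.foldr (fun _ S => (∅ : Finset (TPt d N')) ∪ S) ∅)
              (fun ω u => Sum.elim
                (fun (p : List LR.B × L₀.B) => (1 / 2 : ℂ) • p.1.foldr (fun i M => M * LR.op i u) (L₀.op p.2 u))
                (fun (p : List LR.B × L₀.B) => (1 / 2 : ℂ) • (p.1.foldr (fun i M => M * LR.op i u) (L₀.op p.2 u))ᵀ) ω)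
              σ u *
            C.map (algebraMap ℝ ℂ)) X R
          (ε - η - μ' - μ') (κ - μ' - μ')
          ((mF * B6.c0 1 μ' ^ ν) * ((mF * B6.c0 1 μ' ^ ν) * Real.exp ((ρ - η) * rC) *
            (Real.exp (c.κ₁ * (0 : ℕ)) * ((lam₀ * Real.exp (μ * r₀) * (n₀ * B6.c0 1 μ ^ ν)) *
              (1 - (m * B6.c0 1 μ ^ ν) * (Real.exp ((ρR - (ρ - ε)) * s) *
                (lamR * Real.exp (μ * rR) * (nR * B6.c0 1 μ ^ ν))) * B6.c0 1 μ ^ ν)⁻¹))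
            * B6.c0 1 μ' ^ ν) * Real.exp ((ρ - η - μ') * rC) * B6.c0 1 μ' ^ ν) T' SX' A' D' ρ' ∧
        (∀ ω σ u, T' ω σ u = (∏ j ∈ J' ω, σ j) • T0' ω u) ∧ (∀ ω σ u i j, T' (rev' ω) σ u i j = T' ω σ u j i) :=
  structuredExpansion_of_factorData h₀ hR hκ₁ hlam₀ hlamR hfib hμ hε hκ hwin hρR hρ₀ hs hq
    (fun _ => ∅) (fun _ => ∅) (nc := 0) (fun _ => by simp) (fun _ => by simp)
    (fun _ h => absurd h Finset.not_nonempty_empty) (fun _ h => absurd h Finset.not_nonempty_empty)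
    hη hηε (by simp only [Nat.cast_zero, mul_zero]; exact mul_nonneg hη hs) C hCle hCsupp hfibF hμ' hμ'ε hμ'κ

/-- **… AND THE OPERATOR IT EXPANDS IS σ-FREE**: with the empty assignment the conditioned operator of module 28's conclusion
does not depend on the parameters `s(Δ)` at all — so the `hKexp`-shaped datum is inhabited by the σ-CONSTANT operator
`u ↦ Cᵀ·(Σ_ω T₀ˢʸᵐ(ω,u))·C`, on which every (2.14) term with `Z ⊋ Z′₀` vanishes (§2).  The cube letters are one-sided
sufficient conditions; the s-dependence of record is owed by the OBJECT `J(ω)` = the σ₀-cubes met by `ω` (p. 13), not by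
the letters. [cite: Balaban1988RG2Cluster, p.13, (1.11) p.5, (2.14) p.15] -/
theorem structuredExpansion_of_factorData_emptyCubes_sigmaFree
    (h₀ : IsDomainLocalD L₀ c locn locn X R lam₀ ρ₀ r₀ 0 n₀) (hR : IsDomainLocalD LR c locn locn X R lamR ρR rR 0 nR)
    (hκ₁ : 0 ≤ c.κ₁) (hlam₀ : 0 ≤ lam₀) (hlamR : 0 ≤ lamR)
    (hfib : ∀ y : UT Nf, (Finset.univ.filter fun k => locn k = y).card ≤ m)
    {ρ ε κ μ s : ℝ} (hμ : 0 < μ) (hε : 0 ≤ ε) (hκ : 0 ≤ κ) (hwin : κ + 2 * μ ≤ ρ - ε) (hρR : ρ + μ ≤ ρR) (hρ₀ : ρ ≤ ρ₀)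
    (hs : 0 ≤ s)
    (hq : (m * B6.c0 1 μ ^ ν) * (Real.exp ((ρR - (ρ - ε)) * s) * (lamR * Real.exp (μ * rR) * (nR * B6.c0 1 μ ^ ν))) *
      B6.c0 1 μ ^ ν < 1)
    {η : ℝ} (hη : 0 ≤ η) (hηε : η ≤ ε)
    (C : Matrix n q ℝ) {rC : ℝ} (hCle : ∀ k i, |C k i| ≤ 1)
    (hCsupp : ∀ k i, C k i ≠ 0 → tdist1 Nf (locn k) (locN i) ≤ rC)
    {mF : ℕ} (hfibF : ∀ y : UT Nf, (Finset.univ.filter fun k => locn k = y).card ≤ mF)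
    {μ' : ℝ} (hμ' : 0 < μ') (hμ'ε : 2 * μ' ≤ ε - η) (hμ'κ : 2 * μ' ≤ κ) :
    ∃ (W' : Type) (T' : W' → (TPt d N' → ℂ) → E → Matrix q q ℂ) (SX' : Set W') (A' : W' → ℝ)
      (D' : W' → UT Nf → UT Nf → ℝ) (ρ' : ℝ) (J' : W' → Finset (TPt d N')) (T0' : W' → E → Matrix q q ℂ) (rev' : W' ≃ W'),
      JointWalkExpansion c locN locN
          (fun _ u => (C.map (algebraMap ℝ ℂ))ᵀ *
            sDecorate (fun _ : (List LR.B × L₀.B) ⊕ (List LR.B × L₀.B) => (∅ : Finset (TPt d N')))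
              (fun ω u => Sum.elim
                (fun (p : List LR.B × L₀.B) => (1 / 2 : ℂ) • p.1.foldr (fun i M => M * LR.op i u) (L₀.op p.2 u))
                (fun (p : List LR.B × L₀.B) => (1 / 2 : ℂ) • (p.1.foldr (fun i M => M * LR.op i u) (L₀.op p.2 u))ᵀ) ω)
              0 u *
            C.map (algebraMap ℝ ℂ)) X R
          (ε - η - μ' - μ') (κ - μ' - μ')
          ((mF * B6.c0 1 μ' ^ ν) * ((mF * B6.c0 1 μ' ^ ν) * Real.exp ((ρ - η) * rC) *
            (Real.exp (c.κ₁ * (0 : ℕ)) * ((lam₀ * Real.exp (μ * r₀) * (n₀ * B6.c0 1 μ ^ ν)) *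
              (1 - (m * B6.c0 1 μ ^ ν) * (Real.exp ((ρR - (ρ - ε)) * s) *
                (lamR * Real.exp (μ * rR) * (nR * B6.c0 1 μ ^ ν))) * B6.c0 1 μ ^ ν)⁻¹))
            * B6.c0 1 μ' ^ ν) * Real.exp ((ρ - η - μ') * rC) * B6.c0 1 μ' ^ ν) T' SX' A' D' ρ' ∧
        (∀ ω σ u, T' ω σ u = (∏ j ∈ J' ω, σ j) • T0' ω u) ∧ (∀ ω σ u i j, T' (rev' ω) σ u i j = T' ω σ u j i) := by
  obtain ⟨W', T', SX', A', D', ρ', J', T0', rev', hJ, hmono, hrev⟩ :=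
    structuredExpansion_of_factorData_emptyCubes h₀ hR hκ₁ hlam₀ hlamR hfib hμ hε hκ hwin hρR hρ₀ hs hq hη hηε C hCle
      hCsupp hfibF hμ' hμ'ε hμ'κ
  refine ⟨W', T', SX', A', D', ρ', J', T0', rev', jointWalkExpansion_congr_on hJ fun σ _ u _ => ?_, hmono, hrev⟩
  have hJe : ∀ ω : (List LR.B × L₀.B) ⊕ (List LR.B × L₀.B),
      (Sum.elim id id ω).1.foldr (fun _ S => (∅ : Finset (TPt d N')) ∪ S) ∅ = (∅ : Finset (TPt d N')) :=
    fun ω => foldr_empty_union _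
  congr 2
  ext i j
  simp only [sDecorate_apply, sTerm_apply, hJe, Finset.prod_empty]

end EmptyCubes

/-! ## §4 (T-57.4). The common affine form of the two absorption letters -/

section Affine

variable {W S : Type*} {ι' : Type*}

/-- **AFFINE ABSORPTION FROM AN AFFINE CUBE COUNT**: `|J ω| ≤ m₀ + λ·D ω a b` (`λ ≥ 0`) gives the (1.11) absorption
hypothesis of `B13Eq111SDecoupling.jointWalkExpansion_sDecorate` with the letters `m₀` and `η := κ₁λ`.
[cite: Balaban1988RG2Cluster, (1.11) p.5 and p.13] -/
theorem absorb_of_card_le_affine (J : W → Finset ι') {m₀ lam κ₁ : ℝ} (hκ₁ : 0 ≤ κ₁) {D : W → S → S → ℝ}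
    (hJ : ∀ ω a b, ((J ω).card : ℝ) ≤ m₀ + lam * D ω a b) (ω : W) (a b : S) :
    κ₁ * ((J ω).card : ℝ) ≤ κ₁ * m₀ + (κ₁ * lam) * D ω a b := by
  have h := mul_le_mul_of_nonneg_left (hJ ω a b) hκ₁
  linarith [h]

/-- **The GEODESIC letter** (companion 19 §3: `|J ω| ≤ c₀ + D ω a b ∕ M₁` — the cubes met by a connected set joining the
two located ends are paid by its LENGTH): absorption with `m₀ = c₀`, `η = κ₁∕M₁`; the rate condition `η ≤ ε` reads
`κ₁ ≤ εM₁`. [cite: Balaban1988RG2Cluster, (1.11) p.5, p.13; Balaban1985BackgroundPropagators, (3.108) p.416] -/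
theorem absorb_geodesic (J : W → Finset ι') {c₀ M₁ κ₁ : ℝ} (hκ₁ : 0 ≤ κ₁) {D : W → S → S → ℝ}
    (hJ : ∀ ω a b, ((J ω).card : ℝ) ≤ c₀ + D ω a b / M₁) (ω : W) (a b : S) :
    κ₁ * ((J ω).card : ℝ) ≤ κ₁ * c₀ + (κ₁ / M₁) * D ω a b := by
  have h := absorb_of_card_le_affine J hκ₁ (lam := 1 / M₁) (D := D)
    (fun ω a b => by simpa [div_eq_mul_inv, mul_comm] using hJ ω a b) ω a b
  simpa [div_eq_mul_inv] using h

/-- **The CHAIN letter** (module 28 §3: `|J ω| ≤ n_c(|l ω| + 1)` — the cubes are counted PER STEP, the walk distance of a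
chain need not grow with its number of steps): with a per-step penalty `s > 0` ADDED to the distance (`D′ = D + s|l|`,
`D ≥ 0`) it is the affine count with `m₀ = n_c`, `λ = n_c∕s`, i.e. `η = κ₁n_c∕s` — module 28's `absorb_chain` letter
`κ₁n_c ≤ ηs` (which also covers `s = 0`, `n_c = 0`). [cite: Balaban1988RG2Cluster, (1.11) p.5, p.13; Balaban1985BackgroundPropagators, (3.108) p.416] -/
theorem card_le_affine_of_chain (J : W → Finset ι') (len : W → ℕ) {nc : ℕ} {s : ℝ} (hs : 0 < s)
    (hJ : ∀ ω, (J ω).card ≤ nc * (len ω + 1)) {D : W → S → S → ℝ} (hD : ∀ ω a b, 0 ≤ D ω a b) (ω : W) (a b : S) :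
    ((J ω).card : ℝ) ≤ nc + (nc / s) * (D ω a b + s * len ω) := by
  have h1 : ((J ω).card : ℝ) ≤ nc * (len ω + 1) := by exact_mod_cast hJ ω
  have h2 : (nc / s) * (D ω a b + s * len ω) = (nc / s) * D ω a b + nc * len ω := by
    have e : (nc : ℝ) / s * (s * (len ω : ℝ)) = nc * len ω := by
      rw [← mul_assoc, div_mul_cancel₀ (nc : ℝ) hs.ne']
    rw [mul_add, e]
  rw [h2]
  have h3 : 0 ≤ (nc / s) * D ω a b := mul_nonneg (div_nonneg (Nat.cast_nonneg _) hs.le) (hD ω a b)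
  nlinarith [h1, h3]

end Affine

end Literature.MathematicalPhysics.QuantumFieldTheory.Balaban1983to89.B13SigmaFreeKernels

end
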